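import Summits.QuantumFields.QCD.Theses.GapBuysCauchyRate
import Literature.MathematicalPhysics.QuantumFieldTheory.GaugeCovariantBlockMap

/-!
# Stub `stub_farResponseSummable` of line `birth` for crux `GapBuysCauchyRate.LadderCauchyRate`
(item stmt-QuantumFields-17307, route route-QuantumFields-GapBuysCauchyRate, sub-problem QCD)

What is proved: the summation lemma `(S3a) → (S3)` of the birth skeleton.  ASSUMING the 4-d
lattice exponential-sum bound (S3a) `Σ_{x ∈ box 4 S'} e^{−μ dist(a·x, y)} ≤ K / a⁴` (uniformly in
`y`, `S'` and `0 < a ≤ 1`), the exponential clustering hypothesis with scale-covariant prefactor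
`‖⟨Φ(f₁)⋯Φ(fₙ); O(x)⟩‖ ≤ C a_k^d Σᵢ ∫ |fᵢ(y)| e^{−μ dist(a_k x, y)} dy` at every `δ`-far point `x`
is turned into the volume bound `Σ_{x ∈ T} ‖⟨…; O(x)⟩‖ ≤ C' a_k^{d−4}` for every finite set `T`
of `δ`-far points of the torus box, with `C' = |C| · K · Σᵢ ‖fᵢ‖_{L¹}` independent of `k, S', T`.

How: eventually `a_k ≤ 1` (`reg.tendsto_a`); termwise clustering bound (with `C ≤ |C|`); swap the
two finite sums; for each `i` swap `Σ_{x ∈ T}` with the integral (`integral_finsetSum`, the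
integrand `|fᵢ| · e^{−μ dist}` being integrable because `fᵢ` is Schwartz and `0 < e^{…} ≤ 1`),
bound `Σ_{x ∈ T} ≤ Σ_{x ∈ box} ≤ K / a_k⁴` inside the integral (`integral_mono_of_nonneg`), and
finish with `a^d / a⁴ = a^{d−4}` (`pow_sub₀`, `4 ≤ d`).  Sources: Mathlib only.

Pure theorem file (no definitions): the registered stub signature, proved in tree vocabulary.
-/

noncomputable section

namespace Summit.QuantumFields.QCD.Cruxes.LadderCauchyRate.Birth

open scoped BigOperators Topology Classical
open MeasureTheory Filter
open Literature.MathematicalPhysics.AQFT Literature.Probability.LatticeModels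
  Literature.MathematicalPhysics.QuantumLattice Literature.MathematicalPhysics.QuantumFieldTheory
open Summit.QuantumFields.QCD.Theses.GapBuysCauchyRate

/-- Fubini step of the summation lemma: if the finite exponential sum `Σ_{x ∈ T} e^{−μ dist(c x, y)}`
is bounded by `B` uniformly in `y`, then `Σ_{x ∈ T} ∫ |g| e^{−μ dist(c x, ·)} ≤ B · ∫ |g|` for every
Schwartz function `g` (each integrand is integrable: `g` is integrable and `0 < e^{…} ≤ 1`). -/
private theorem sum_integral_abs_mul_exp_le {ι : Type*} (T : Finset ι)
    (c : ι → EuclideanSpace ℝ (Fin 4)) {μ : ℝ} (hμ : 0 ≤ μ) (B : ℝ)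
    (g : SchwartzMap (EuclideanSpace ℝ (Fin 4)) ℝ)
    (hB : ∀ y, ∑ x ∈ T, Real.exp (-(μ * dist (c x) y)) ≤ B) :
    ∑ x ∈ T, ∫ y, |g y| * Real.exp (-(μ * dist (c x) y)) ≤ B * ∫ y, |g y| := by
  have hg : Integrable (fun y => |g y|) volume := (SchwartzMap.integrable g).abs
  have hint : ∀ x ∈ T,
      Integrable (fun y => |g y| * Real.exp (-(μ * dist (c x) y))) volume := by
    intro x _
    refine hg.mul_bdd (c := 1) (Continuous.aestronglyMeasurable (by fun_prop)) (ae_of_all _ ?_)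
    intro y
    rw [Real.norm_of_nonneg (Real.exp_nonneg _), Real.exp_le_one_iff, neg_nonpos]
    exact mul_nonneg hμ dist_nonneg
  rw [← integral_finsetSum T hint]
  calc ∫ y, ∑ x ∈ T, |g y| * Real.exp (-(μ * dist (c x) y))
      = ∫ y, |g y| * ∑ x ∈ T, Real.exp (-(μ * dist (c x) y)) := by
        simp only [Finset.mul_sum]
    _ ≤ ∫ y, |g y| * B :=
        integral_mono_of_nonneg
          (ae_of_all _ fun y => mul_nonneg (abs_nonneg _)
            (Finset.sum_nonneg fun _ _ => Real.exp_nonneg _))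
          (hg.mul_const B) (ae_of_all _ fun y => mul_le_mul_of_nonneg_left (hB y) (abs_nonneg _))
    _ = B * ∫ y, |g y| := by
        rw [integral_mul_const, mul_comm]

/-- (S3b) **lattice exponential sum ⇒ summable far response** — size M, provable now (lead reshape
r2).  Registered signature = `(S3a) → FarResponseSummableStmt` written out (pointwise, `T`-form):
eventually `a_k ≤ 1`; `Σ_{x ∈ T} ≤ Σ_{x ∈ box}`; Fubini for the finite sum against `∫ |fᵢ| e^{−μ dist}`
(`fᵢ` Schwartz ⇒ integrable); (S3a) inside the integral; `a^d · a^{−4} = a^{d−4}` for `d ≥ 4`. -/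
theorem stub_farResponseSummable :
    (∀ μ : ℝ, 0 < μ → ∃ K : ℝ, ∀ a : ℝ, 0 < a → a ≤ 1 →
      ∀ (y : EuclideanSpace ℝ (Fin 4)) (S' : ℕ),
        ∑ x ∈ Literature.Probability.LatticeModels.box 4 S',
          Real.exp (-(μ * dist (a • siteToE x) y)) ≤ K / a ^ 4) →
    ∀ (Nf : ℕ) (reg : QCDRegularisation Nf) (𝒞 : CalibratedSpeciesFamily reg) (m : Fin Nf → ℝ)
      (R : ℕ) (O : ℕ → QCDLatticeObservable Nf R) (d : ℕ), 4 ≤ d →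
      ∀ (n : ℕ) (σ : Fin n → QCDField Nf) (f : Fin n → SchwartzMap (EuclideanSpace ℝ (Fin 4)) ℝ)
        (δ : ℝ), 0 < δ →
        (∃ μ : ℝ, 0 < μ ∧ ∃ C : ℝ, ∀ᶠ k in Filter.atTop, ∀ S' : ℕ, reg.L k ≤ S' →
          ∀ x ∈ Literature.Probability.LatticeModels.box 4 S',
            (∀ i, ∀ y ∈ tsupport (f i : EuclideanSpace ℝ (Fin 4) → ℝ),
                δ ≤ dist (reg.a k • siteToE x) y) →
              ‖insertionCorr (𝒞.scheme m) k S' n σ f (O k) x‖ ≤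
                C * reg.a k ^ d * ∑ i, ∫ y, |f i y| * Real.exp (-(μ * dist (reg.a k • siteToE x) y))) →
        ∃ C : ℝ, ∀ᶠ k in Filter.atTop, ∀ S' : ℕ, reg.L k ≤ S' →
          ∀ T : Finset (Literature.Probability.LatticeModels.Site 4),
            T ⊆ Literature.Probability.LatticeModels.box 4 S' →
            (∀ x ∈ T, ∀ i, ∀ y ∈ tsupport (f i : EuclideanSpace ℝ (Fin 4) → ℝ),
                δ ≤ dist (reg.a k • siteToE x) y) →
              ∑ x ∈ T, ‖insertionCorr (𝒞.scheme m) k S' n σ f (O k) x‖ ≤ C * reg.a k ^ (d - 4) := by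
  intro hK Nf reg 𝒞 m R O d hd n σ f δ _hδ hclust
  obtain ⟨μ, hμ, C, hC⟩ := hclust
  obtain ⟨K, hK⟩ := hK μ hμ
  have ha1 : ∀ᶠ k in Filter.atTop, reg.a k ≤ 1 := reg.tendsto_a.eventually_le_const one_pos
  refine ⟨|C| * K * ∑ i, ∫ y, |f i y|, ?_⟩
  filter_upwards [hC, ha1] with k hk hak
  intro S' hS' T hT hfar
  have ha : 0 < reg.a k := reg.a_pos k
  -- (S3a) on the sub-box `T ⊆ box 4 S'`, uniformly in `y`
  have hB : ∀ y : EuclideanSpace ℝ (Fin 4),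
      ∑ x ∈ T, Real.exp (-(μ * dist (reg.a k • siteToE x) y)) ≤ K / reg.a k ^ 4 := fun y =>
    (Finset.sum_le_sum_of_subset_of_nonneg hT fun _ _ _ => Real.exp_nonneg _).trans
      (hK (reg.a k) ha hak y S')
  -- termwise clustering bound, with `C ≤ |C|`
  have hpt : ∀ x ∈ T, ‖insertionCorr (𝒞.scheme m) k S' n σ f (O k) x‖ ≤
      |C| * reg.a k ^ d *
        ∑ i, ∫ y, |f i y| * Real.exp (-(μ * dist (reg.a k • siteToE x) y)) := by
    intro x hx
    refine (hk S' hS' x (hT hx) (hfar x hx)).trans (mul_le_mul_of_nonneg_right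
      (mul_le_mul_of_nonneg_right (le_abs_self C) (pow_nonneg ha.le d)) ?_)
    exact Finset.sum_nonneg fun i _ => integral_nonneg fun y =>
      mul_nonneg (abs_nonneg _) (Real.exp_nonneg _)
  calc ∑ x ∈ T, ‖insertionCorr (𝒞.scheme m) k S' n σ f (O k) x‖
      ≤ ∑ x ∈ T, |C| * reg.a k ^ d *
          ∑ i, ∫ y, |f i y| * Real.exp (-(μ * dist (reg.a k • siteToE x) y)) :=
        Finset.sum_le_sum hpt
    _ = |C| * reg.a k ^ d *
          ∑ i, ∑ x ∈ T, ∫ y, |f i y| * Real.exp (-(μ * dist (reg.a k • siteToE x) y)) := by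
        rw [← Finset.mul_sum, Finset.sum_comm]
    _ ≤ |C| * reg.a k ^ d * ∑ i, K / reg.a k ^ 4 * ∫ y, |f i y| := by
        gcongr with i _
        exact sum_integral_abs_mul_exp_le T (fun x => reg.a k • siteToE x) hμ.le _ (f i) hB
    _ = |C| * K * (∑ i, ∫ y, |f i y|) * reg.a k ^ (d - 4) := by
        rw [← Finset.mul_sum, pow_sub₀ _ ha.ne' hd]
        field_simp

end Summit.QuantumFields.QCD.Cruxes.LadderCauchyRate.Birth

end
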